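/-
Copyright (c) 2026 the pub-hodgecm-mathlib formalisation cell (harness21).  Prover seat hodgecm-mathlib-K2E1-p15 (g3), Track B ∕ K2-LIT, h413 = `stmt-HodgeConjecture-24833`,
R90-TF section S8 «ContSpec-n½» (planner R90-CS-plan (g0), cut (α) 2026-09-04T16:11:02Z on this seat's J1 census): J1a-dict — the local components of the RESTRICTION `χ|_{𝕀_F}` of a Hecke
character `χ` of `E` at a finite place `v` of `F` are the products over `w ∣ v` of the local components of `χ` (the dictionary K2Liu's rank-one files leave as «the consumer's one rewrite»).
-/
import Literature.NumberTheory.Automorphic.QuadraticLocalBaseChange        -- ★ `UnitaryGroup.PlacesOver`, `toPlace v w : F_v →+* E_w`, `valued_toPlace`; brings ★ `AdeleBaseChange` (`AdeleRing.ideleBaseChange`, `FiniteAdeleRing.baseChange_apply`) and `Fintype (PlacesOver E v)`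
import Literature.NumberTheory.GaloisRepresentations.HeckeCharacter        -- ★ `HeckeCharacter`, `localUnits`, `finiteAdeleSingle`, `localComponent`, `IsUnramifiedAt`, `uniformizer`, `valueAtUniformizer`, `localComponent_eq_valueAtUniformizer`
import Literature.NumberTheory.GaloisRepresentations.UnitIdelesHerbrand    -- ★ `IdeleHerbrand.snd_prod_apply` ∕ `IdeleHerbrand.fst_prod` (components of a finite product of ideles)
import HarnessLib

/-!
# J1a-dict — `K2E1HeckeCharBaseChangeLocalComponentsU`: for a Hecke character `χ` of `E` and `ε = χ|_{𝕀_F}` (restriction along ★ `AdeleRing.ideleBaseChange F E`), at a finite place `v` of `F`: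
# `ε_v(u) = ∏_{w ∣ v} χ_w(ι_w u)`, `ε` is unramified at `v` when the `χ_w` are, and `ε(ϖ_v) = ∏_{w ∣ v} χ_w(ι_w ϖ_v)` for ANY uniformizer `ϖ_v` of `F_v`

Track B ∕ K2-LIT, crux h413 = `stmt-HodgeConjecture-24833`, route of record `HCCMUnconditional`; cell `hodgecm-mathlib`, R90-TF programme, section S8 «ContSpec-n½», socket #4
road (R2-χ ∕ J1: the junction between E1's GLOBAL token `ε.valueAtUniformizer v` of ★ `K2E1ChiIntertwiningScalarEulerQuotientU2` and K2Liu's LOCAL Satake value `unramValue (chiF χ_v)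
= ∏_{w∣v} χ_w(ι_w ϖ_v)` of ★ `K2LiuGKRankOneIdentityLFactor.unramValue_chiF_eq_prod`; ★ `K2LiuGoodPlaceWhittakerUnimodularValueCM` §6 names this rewrite «`α = ε(ϖ_v)`» and leaves it to
the consumer; the tree had it only for the parity instance ★ `K2E1QuadraticHeckeCharCMPlaceValues`).  GENERIC: any extension of number fields `F ⊂ E` (no CM, no degree hypothesis).
THEOREMS ONLY (no `def`, no `instance`, no `notation`, no named-fact hypothesis, no `sorry`; default heartbeats); lane `--supports stmt-HodgeConjecture-24833 --as helper` (count-neutral).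

THE MATHEMATICS ([TateThesis1967, §3.2 and §4.3]; [CasselsFrohlichANT1967, Ch. II §10–§11, §14]; [NeukirchANT1999, Ch. VI §1, Ch. VII §6]).  `𝔸_E = 𝔸_F ⊗_F E` and
`E ⊗_F F_v = ∏_{w ∣ v} E_w`, so the idele `⟨u⟩_v ∈ 𝕀_F` (`u ∈ F_vˣ` at `v`, `1` elsewhere; ★ `localUnits v u`) maps under base change to the idele of `E` which is `ι_w(u)` at each `w ∣ v` and
`1` elsewhere, i.e. `(⟨u⟩_v)_E = ∏_{w ∣ v} ⟨ι_w u⟩_w` (§1 `ideleBaseChange_localUnits`, checked componentwise: ★ `FiniteAdeleRing.baseChange_apply`, `finiteAdeleSingle_apply_self∕_of_ne`).  Hence for a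
Hecke character `χ` of `E`: `χ((⟨u⟩_v)_E) = ∏_{w ∣ v} χ_w(ι_w u)` (§2), and if `ε` is a Hecke character of `F` with `χ ∘ (base change) = ε` («`ε = χ|_{𝕀_F}`», hypothesis-first — the tree has no
restriction constructor) then `ε_v(u) = ∏_{w ∣ v} χ_w(ι_w u)` (§2 `localComponent_eq_prod_of_comp_ideleBaseChange`); `ε` is unramified at `v` as soon as every `χ_w`, `w ∣ v`, kills the
valuation-`1` units (`|ι_w u|_w = |u|_v^{e(w|v)} = 1`, ★ `valued_toPlace`; §3); and then `ε(ϖ) = ∏_{w ∣ v} χ_w(ι_w ϖ)` for EVERY uniformizer `ϖ` of `F_v` (★ `localComponent_eq_valueAtUniformizer`;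
§3 `valueAtUniformizer_eq_prod_of_comp_ideleBaseChange`, stated with K2Liu's binders `Units.mk0 (toPlace v w ϖ) (hϖ0 w)` so that ★ `unramValue_chiF_eq_prod` rewrites it into
`unramValue (chiF (fun w => χ_w))` — J1a-arith, next file).
* §1 `adicCompletionOfUnder_apply_eq_toPlace` (the `w.under = v` transport, `subst; rfl`), **`ideleBaseChange_localUnits`** — `(⟨u⟩_v)_E = ∏_{w ∣ v} ⟨ι_w u⟩_w` (components of a
  finite product of ideles by ★ `IdeleHerbrand.snd_prod_apply` ∕ `fst_prod`).
* §2 **`apply_ideleBaseChange_localUnits`** — `χ((⟨u⟩_v)_E) = ∏_{w∣v} χ_w(ι_w u)`; **`localComponent_eq_prod_of_comp_ideleBaseChange`** — `ε_v(u) = ∏_{w∣v} χ_w(ι_w u)`.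
* §3 **`isUnramifiedAt_of_comp_ideleBaseChange`**; **`valueAtUniformizer_eq_prod_of_comp_ideleBaseChange`** — THE HEAD (K2Liu binder shape).
HONEST LABEL: HC_CM is proved only modulo the 7 printed citations (2 remaining named inputs: hLiu418 = `stmt-HodgeConjecture-24832`, h413 = `stmt-HodgeConjecture-24833`) until
rung 0 closes; this file asserts no named fact and closes no socket; count-neutral.

## References
* [TateThesis1967] J. Tate, *Fourier analysis in number fields and Hecke's zeta-functions* (1950), in Cassels–Fröhlich (1967): §3.2 (local components of quasi-characters of restricted products), §4.3.
* [CasselsFrohlichANT1967] J. W. S. Cassels, A. Fröhlich (eds.), *Algebraic Number Theory* (1967): Ch. II §10–§11 (`L ⊗_K K_v = ∏_{w∣v} L_w`), §14 (adeles under base change).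
* [NeukirchANT1999] J. Neukirch, *Algebraic Number Theory* (1999): Ch. VI §1 (ideles), Ch. VII §6 (6.10)–(6.12) (local components, unramified characters, `χ(𝔭)`).
-/

set_option autoImplicit false
set_option linter.dupNamespace false  -- the mandated namespace repeats the summit's segment (`HodgeConjecture.HodgeConjecture`)

noncomputable section

open NumberField IsDedekindDomain
open Literature.NumberTheory.Automorphic Literature.NumberTheory.Automorphic.UnitaryGroup
open Literature.NumberTheory.GaloisRepresentations

namespace Summit.HodgeConjecture.HodgeConjecture.Cruxes.H413.K2E1HeckeCharBaseChangeLocalComponentsU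

variable (F E : Type) [Field F] [NumberField F] [Field E] [NumberField E] [Algebra F E]

/-! ## §1 Idele plumbing: `(⟨u⟩_v)_E = ∏_{w ∣ v} ⟨ι_w u⟩_w` -/

omit [NumberField F] [NumberField E] in
variable {F E} in
/-- The base-change component map at a place `w` above `v` IS `ι_w = toPlace v w` once the argument is read at `v = w ∩ 𝓞_F` (transport along `w.under = v`). [folklore] -/
theorem adicCompletionOfUnder_apply_eq_toPlace [NumberField F] [NumberField E] {v : HeightOneSpectrum (𝓞 F)} (w : PlacesOver E v)
    (x : ∀ p : HeightOneSpectrum (𝓞 F), p.adicCompletion F) :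
    adicCompletionOfUnder (𝓞 F) F E w.1 (x (w.1.under (𝓞 F))) = toPlace v w (x v) := by
  obtain ⟨w, hw⟩ := w
  subst hw
  rfl

variable {F E} in
/-- **`(⟨u⟩_v)_E = ∏_{w ∣ v} ⟨ι_w u⟩_w`**: the base change of the idele of `F` supported at `v` with value `u` is the product over the places `w ∣ v` of the ideles of `E` supported
at `w` with value `ι_w u` (`E ⊗_F F_v = ∏_{w∣v} E_w`). [cite: CasselsFrohlichANT1967, Ch. II §10–§11, §14] [cite: TateThesis1967, §3.2] -/
theorem ideleBaseChange_localUnits (v : HeightOneSpectrum (𝓞 F)) (u : (v.adicCompletion F)ˣ) :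
    AdeleRing.ideleBaseChange F E (localUnits v u) =
      ∏ w : PlacesOver E v, localUnits w.1 (Units.map (toPlace v w : v.adicCompletion F →* w.1.adicCompletion E) u) := by
  apply Units.ext
  refine Prod.ext ?_ ?_
  · -- infinite components: `1` on both sides
    rw [AdeleRing.coe_ideleBaseChange, AdeleRing.baseChange_fst, localUnits_fst, map_one, IdeleHerbrand.fst_prod]
    exact (Finset.prod_eq_one fun w _ => rfl).symm
  · -- finite components, place by place
    refine FiniteAdeleRing.ext E fun w' => ?_
    rw [AdeleRing.coe_ideleBaseChange, AdeleRing.baseChange_snd, FiniteAdeleRing.baseChange_apply, IdeleHerbrand.snd_prod_apply]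
    by_cases hw' : w'.under (𝓞 F) = v
    · -- `w'` lies over `v`: both sides are `ι_{w'} u`
      rw [adicCompletionOfUnder_apply_eq_toPlace ⟨w', hw'⟩ (fun p => ((localUnits v u : ideleGroup F) : AdeleRing (𝓞 F) F).2 p),
        localUnits_snd_apply_self, Finset.prod_eq_single (⟨w', hw'⟩ : PlacesOver E v)]
      · exact (localUnits_snd_apply_self w' (Units.map (toPlace v ⟨w', hw'⟩ : v.adicCompletion F →* w'.adicCompletion E) u)).symm
      · intro w _ hne
        exact finiteAdeleSingle_apply_of_ne _ fun h => hne (Subtype.ext h.symm)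
      · intro h
        exact absurd (Finset.mem_univ _) h
    · -- `w'` does not lie over `v`: both sides are `1`
      have hne : w'.under (𝓞 F) ≠ v := hw'
      rw [show ((localUnits v u : ideleGroup F) : AdeleRing (𝓞 F) F).2 (w'.under (𝓞 F)) = 1 from finiteAdeleSingle_apply_of_ne _ hne, map_one]
      refine (Finset.prod_eq_one fun w _ => ?_).symm
      exact finiteAdeleSingle_apply_of_ne _ fun h => hne (h ▸ w.2)

/-! ## §2 The character level: `χ((⟨u⟩_v)_E) = ∏_{w∣v} χ_w(ι_w u)` and the local components of `χ|_{𝕀_F}` -/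

variable {F E} in
/-- **`χ((⟨u⟩_v)_E) = ∏_{w ∣ v} χ_w(ι_w u)`** for a Hecke character `χ` of `E` (§1 and multiplicativity). [cite: TateThesis1967, §4.3] -/
theorem apply_ideleBaseChange_localUnits (χ : HeckeCharacter E) (v : HeightOneSpectrum (𝓞 F)) (u : (v.adicCompletion F)ˣ) :
    χ (AdeleRing.ideleBaseChange F E (localUnits v u)) =
      ∏ w : PlacesOver E v, χ.localComponent w.1 (Units.map (toPlace v w : v.adicCompletion F →* w.1.adicCompletion E) u) := by
  rw [ideleBaseChange_localUnits]
  change χ.toContinuousMonoidHom.toMonoidHom _ = _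
  rw [map_prod]
  rfl

variable {F E} in
/-- **Local components of the restriction `ε = χ|_{𝕀_F}`** (hypothesis-first: `χ ∘ ideleBaseChange = ε`): `ε_v(u) = ∏_{w ∣ v} χ_w(ι_w u)` for every `u ∈ F_vˣ`.
[cite: TateThesis1967, §3.2 and §4.3] [cite: CasselsFrohlichANT1967, Ch. II §11] -/
theorem localComponent_eq_prod_of_comp_ideleBaseChange (χ : HeckeCharacter E) (ε : HeckeCharacter F)
    (hε : ∀ a : ideleGroup F, χ (AdeleRing.ideleBaseChange F E a) = ε a) (v : HeightOneSpectrum (𝓞 F)) (u : (v.adicCompletion F)ˣ) :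
    ε.localComponent v u =
      ∏ w : PlacesOver E v, χ.localComponent w.1 (Units.map (toPlace v w : v.adicCompletion F →* w.1.adicCompletion E) u) := by
  rw [HeckeCharacter.localComponent_apply, ← hε, apply_ideleBaseChange_localUnits]

/-! ## §3 Unramifiedness and the value at ANY uniformizer (K2Liu binder shape) -/

variable {F E} in
/-- **`χ|_{𝕀_F}` is unramified at `v` when every `χ_w`, `w ∣ v`, kills the valuation-one units** (K2Liu's form of unramifiedness): for `u ∈ 𝒪_vˣ`, `|ι_w u|_w = |u|_v^{e(w|v)} = 1`
(★ `valued_toPlace`). [cite: NeukirchANT1999, Ch. VII §6 (6.10)] -/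
theorem isUnramifiedAt_of_comp_ideleBaseChange (χ : HeckeCharacter E) (ε : HeckeCharacter F)
    (hε : ∀ a : ideleGroup F, χ (AdeleRing.ideleBaseChange F E a) = ε a) (v : HeightOneSpectrum (𝓞 F))
    (hχ : ∀ (w : PlacesOver E v) (u : (w.1.adicCompletion E)ˣ), Valued.v (u : w.1.adicCompletion E) = 1 → χ.localComponent w.1 u = 1) :
    ε.IsUnramifiedAt v := by
  intro u
  rw [localComponent_eq_prod_of_comp_ideleBaseChange χ ε hε]
  refine Finset.prod_eq_one fun w _ => hχ w _ ?_
  -- a unit of `𝒪_v` has valuation `1`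
  have hu : Valued.v ((Units.map ((v.adicCompletionIntegers F).subtype : _ →* _) u : (v.adicCompletion F)ˣ) : v.adicCompletion F) = 1 :=
    (Valuation.Integers.isUnit_iff_valuation_eq_one (Valuation.valuationSubring.integers _)).1 (Units.isUnit u)
  rw [Units.coe_map, MonoidHom.coe_coe, valued_toPlace, hu, one_pow]

variable {F E} in
/-- **THE HEAD — `ε(ϖ) = ∏_{w ∣ v} χ_w(ι_w ϖ)` for ANY uniformizer `ϖ` of `F_v`**, `ε = χ|_{𝕀_F}` (hypothesis-first), `χ_w` unramified for `w ∣ v` (K2Liu's valuation form); stated with K2Liu's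
binders `Units.mk0 (toPlace v w ϖ) (hϖ0 w)` so that ★ `K2LiuGKRankOneIdentityLFactor.unramValue_chiF_eq_prod` turns the right-hand side into `unramValue (chiF (fun w => χ_w))` — E1's GLOBAL
token `ε.valueAtUniformizer v` (★ `K2E1ChiIntertwiningScalarEulerQuotientU2`) IS K2Liu's LOCAL Satake parameter. [cite: NeukirchANT1999, Ch. VII §6 (6.12)] [cite: TateThesis1967, §4.3] -/
theorem valueAtUniformizer_eq_prod_of_comp_ideleBaseChange (χ : HeckeCharacter E) (ε : HeckeCharacter F)
    (hε : ∀ a : ideleGroup F, χ (AdeleRing.ideleBaseChange F E a) = ε a) (v : HeightOneSpectrum (𝓞 F))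
    (hχ : ∀ (w : PlacesOver E v) (u : (w.1.adicCompletion E)ˣ), Valued.v (u : w.1.adicCompletion E) = 1 → χ.localComponent w.1 u = 1)
    {ϖ : v.adicCompletion F} (hϖ : Valued.v ϖ = WithZero.exp (-1 : ℤ)) (hϖ0 : ∀ w : PlacesOver E v, toPlace v w ϖ ≠ 0) :
    ε.valueAtUniformizer v = (((∏ w : PlacesOver E v, χ.localComponent w.1 (Units.mk0 (toPlace v w ϖ) (hϖ0 w))) : ℂˣ) : ℂ) := by
  have hϖ0' : ϖ ≠ 0 := fun h => by rw [h, map_zero] at hϖ; exact WithZero.zero_ne_coe hϖ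
  have hmap : ∀ w : PlacesOver E v,
      Units.map (toPlace v w : v.adicCompletion F →* w.1.adicCompletion E) (Units.mk0 ϖ hϖ0') = Units.mk0 (toPlace v w ϖ) (hϖ0 w) :=
    fun w => Units.ext rfl
  rw [← HeckeCharacter.localComponent_eq_valueAtUniformizer (isUnramifiedAt_of_comp_ideleBaseChange χ ε hε v hχ) (ϖ := Units.mk0 ϖ hϖ0') hϖ,
    localComponent_eq_prod_of_comp_ideleBaseChange χ ε hε]
  exact congrArg (fun x : ℂˣ => (x : ℂ)) (Finset.prod_congr rfl fun w _ => by rw [hmap w])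

end Summit.HodgeConjecture.HodgeConjecture.Cruxes.H413.K2E1HeckeCharBaseChangeLocalComponentsU

end
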